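import Summits.KontsevichZagierPeriods.KontsevichZagierPeriods.Theorems.SymplecticScissorsVolumeFormOffPlaneSlackMerge
import Summits.KontsevichZagierPeriods.KontsevichZagierPeriods.Theorems.SymplecticScissorsVolumeFormOffPlaneLogBoxCut
import Summits.KontsevichZagierPeriods.KontsevichZagierPeriods.Theorems.SymplecticScissorsVolumeFormOffPlaneMixedSector

/-!
# `VolumeFormOffPlane` (stmt-KontsevichZagierPeriods-14935) — line `Sketch`,
stub `stub_productCertificate` (the certified class is closed under products)

Toric cells: for `C ⊆ ℝ^p_{>0}` the cell `cell_C = {(x, z) | x ∈ C, 0 < z, z · ∏ x < 1} ⊆ ℝ^{p+1}`.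
A TORSION CERTIFICATE over Λ-boxes for a representation `r` on `cell_C` is an identity
`d • [r] ≡ Σ_j w_j • [σ_j]` modulo `KZ.relations` with `d ≠ 0`, where every `σ_j` of non-zero
weight is an integrand-`1` representation on the cell over a Λ-box
`{x | a_ι < x_ι < a_ι · α^{u_ι} β^{v_ι}}` (`a` positive real algebraic, `u, v` rational,
ratios `> 1`).

If `r` (over `C ⊆ ℝ^p`) and `s` (over `D ⊆ ℝ^q`) carry certificates, then the merged cell `t` over
`C × D` carries the certificate `d d' • [t] ≡ Σ_{j,j'} w_j w'_{j'} • [τ_{j,j'}]`, where `τ_{j,j'}`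
is an integrand-`1` representation on the merged cell over the product box (a Λ-box of torus
dimension `p + q`, data `Fin.append`ed). Proof: `KZ.relations` is a two-sided ideal of the
non-unital ring `KZ.FormalRep` (`KZ.mul_sub_mul_mem_relations`, `KZProductIdeal.lean`), so the two
certificates multiply to `(d • [r]) (d' • [s]) ≡ Σ_{j,j'} w_j w'_{j'} • [σ_j] [σ'_{j'}]`; the slack
merge `[cell_C] · [cell_D] ≡ [cell_{C×D}]` (landed `stub_slackMerge`) is applied on the left to
`[r] [s] ≡ [t]` and on the right to every pair of boxes with non-zero weights; the double sum is
flattened along `finProdFinEquiv`. Merged box representations exist by `stub_logBoxCut` (i)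
(rational powers of positive real-algebraic numbers are real algebraic: `mxs_rpow_isAlgebraic` of
the landed sibling `…VolumeFormOffPlaneMixedSector.lean`).

Sources: M. Kontsevich, D. Zagier, *Periods* (2001), §1.2 rules (1)–(3), §4.1 ("periods form an
algebra", Fubini). The bookkeeping is folklore.
-/

noncomputable section

open MeasureTheory Set
open Literature.NumberTheory.Transcendental Literature.ModelTheory.ExponentialFields

namespace Summit.KontsevichZagierPeriods.SymplecticScissors.LogPolytope

/-! ## Uniform choice of the box data -/

/-- Uniform choice: witnesses `a j, b j, c j` of `Q j → ∃ a b c, P j a b c` as functions of the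
index `j` (arbitrary values where `Q j` fails). [folklore] -/
theorem pcert_choice {ι A B C : Type*} [Nonempty A] [Nonempty B] [Nonempty C] {Q : ι → Prop}
    {P : ι → A → B → C → Prop} (h : ∀ j, Q j → ∃ a b c, P j a b c) :
    ∃ (a : ι → A) (b : ι → B) (c : ι → C), ∀ j, Q j → P j (a j) (b j) (c j) := by
  classical
  have key : ∀ j, ∃ a b c, Q j → P j a b c := fun j => by
    by_cases hq : Q j
    · obtain ⟨a, b, c, hP⟩ := h j hq
      exact ⟨a, b, c, fun _ => hP⟩
    · exact ⟨Classical.arbitrary A, Classical.arbitrary B, Classical.arbitrary C,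
        fun h' => absurd h' hq⟩
  choose a b c H using key
  exact ⟨a, b, c, H⟩

/-! ## The algebra of certificates in the ring `KZ.FormalRep` -/

/-- **Product of two torsion certificates.** In the non-unital ring `KZ.FormalRep`, whose
subgroup `KZ.relations` is a two-sided ideal (`KZ.mul_sub_mul_mem_relations`): from
`d • R ≡ Σ_j w_j • S_j`, `d' • R' ≡ Σ_{j'} w'_{j'} • S'_{j'}`, `R R' ≡ T` and
`S_j S'_{j'} ≡ U_{j j'}` whenever both weights are non-zero, conclude
`d d' • T ≡ Σ_j Σ_{j'} (w_j w'_{j'}) • U_{j j'}`. [folklore] -/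
theorem pcert_algebra {l l' : ℕ} {d d' : ℕ} {w : Fin l → ℤ} {w' : Fin l' → ℤ}
    {R R' T : KZ.FormalRep} {S : Fin l → KZ.FormalRep} {S' : Fin l' → KZ.FormalRep}
    {U : Fin l → Fin l' → KZ.FormalRep}
    (hr : d • R - ∑ j, w j • S j ∈ KZ.relations) (hs : d' • R' - ∑ j, w' j • S' j ∈ KZ.relations)
    (hT : R * R' - T ∈ KZ.relations)
    (hU : ∀ j j', w j ≠ 0 → w' j' ≠ 0 → S j * S' j' - U j j' ∈ KZ.relations) :
    (d * d') • T - ∑ j, ∑ j', (w j * w' j') • U j j' ∈ KZ.relations := by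
  have h1 : (d * d') • T - (d * d') • (R * R') ∈ KZ.relations := by
    have := nsmul_mem (KZ.relations.neg_mem hT) (d * d')
    rwa [neg_sub, smul_sub] at this
  have h2 : (d * d') • (R * R') - ∑ j, ∑ j', (w j * w' j') • (S j * S' j') ∈ KZ.relations := by
    have := KZ.mul_sub_mul_mem_relations hr hs
    simp_rw [Finset.sum_mul, Finset.mul_sum, smul_mul_smul_comm] at this
    exact this
  have h3 : ∑ j, ∑ j', (w j * w' j') • (S j * S' j') - ∑ j, ∑ j', (w j * w' j') • U j j' ∈
      KZ.relations := by
    rw [← Finset.sum_sub_distrib]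
    refine sum_mem fun j _ => ?_
    rw [← Finset.sum_sub_distrib]
    refine sum_mem fun j' _ => ?_
    rw [← smul_sub]
    by_cases hj : w j = 0
    · rw [hj, zero_mul, zero_smul]; exact KZ.relations.zero_mem
    by_cases hj' : w' j' = 0
    · rw [hj', mul_zero, zero_smul]; exact KZ.relations.zero_mem
    exact zsmul_mem (hU j j' hj hj') _
  have := KZ.relations.add_mem (KZ.relations.add_mem h1 h2) h3
  rwa [sub_add_sub_cancel, sub_add_sub_cancel] at this

/-! ## Boxes and merged boxes -/

/-- Open boxes `{x | a_ι < x_ι < b_ι}` with real-algebraic corners are `ℚ`-semialgebraic.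
[folklore] -/
theorem pcert_isSemialgebraic_box {n : ℕ} {a b : Fin n → ℝ} (ha : ∀ ι, IsAlgebraic ℚ (a ι))
    (hb : ∀ ι, IsAlgebraic ℚ (b ι)) :
    IsSemialgebraic ℚ {x : Fin n → ℝ | ∀ ι, a ι < x ι ∧ x ι < b ι} := by
  have hbox : IsSemialgebraic ℚ (⋂ ι ∈ (Finset.univ : Finset (Fin n)),
      ({x : Fin n → ℝ | a ι < x ι} ∩ {x | x ι < b ι})) :=
    IsSemialgebraic.biInter _ _ fun ι _ =>
      (KZ.isSemialgebraic_setOf_const_lt_apply (ha ι) _).inter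
        (KZ.isSemialgebraic_setOf_apply_lt_const (hb ι) _)
  convert hbox using 1
  ext x
  simp

/-- **Merged Λ-boxes carry integrand-`1` representations**: the log-box of torus dimension
`p + q` with appended data `(Fin.append a a', Fin.append u u', Fin.append v v')` has positive
real-algebraic corners, so `stub_logBoxCut` (i) applies. [folklore] -/
theorem pcert_mergedBox_exists {p q : ℕ} {α β : ℝ} (hα : 0 < α) (hβ : 0 < β)
    (hαa : IsAlgebraic ℚ α) (hβa : IsAlgebraic ℚ β) {a : Fin p → ℝ} {a' : Fin q → ℝ}
    (u v : Fin p → ℚ) (u' v' : Fin q → ℚ) (ha : ∀ ι, 0 < a ι) (ha' : ∀ κ, 0 < a' κ)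
    (haa : ∀ ι, IsAlgebraic ℚ (a ι)) (ha'a : ∀ κ, IsAlgebraic ℚ (a' κ)) :
    ∃ τ : KZ.IntegralRep (p + q + 1),
      τ.domain = {ξ : Fin (p + q + 1) → ℝ | (∀ ι : Fin (p + q),
          Fin.append a a' ι < ξ (Fin.castSucc ι) ∧
          ξ (Fin.castSucc ι) < Fin.append a a' ι *
            (α ^ ((Fin.append u u' ι : ℚ) : ℝ) * β ^ ((Fin.append v v' ι : ℚ) : ℝ))) ∧
        0 < ξ (Fin.last (p + q)) ∧
        ξ (Fin.last (p + q)) * ∏ ι : Fin (p + q), ξ (Fin.castSucc ι) < 1} ∧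
      τ.integrand = fun _ => 1 := by
  have hA : ∀ ι, 0 < Fin.append a a' ι := fun ι => by
    induction ι using Fin.addCases with
    | left ι => simpa using ha ι
    | right κ => simpa using ha' κ
  have hAa : ∀ ι, IsAlgebraic ℚ (Fin.append a a' ι) := fun ι => by
    induction ι using Fin.addCases with
    | left ι => simpa using haa ι
    | right κ => simpa using ha'a κ
  exact stub_logBoxCut.1 (p + q) _ _ hA hAa fun ι =>
    (hAa ι).mul ((mxs_rpow_isAlgebraic hα hαa _).mul (mxs_rpow_isAlgebraic hβ hβa _))

/-- The merged box, rewritten in the product shape of `stub_slackMerge` (first `p` torus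
coordinates in the first box, last `q` in the second, common slack). [folklore] -/
theorem pcert_mergedBox_eq {p q : ℕ} (α β : ℝ) (a : Fin p → ℝ) (a' : Fin q → ℝ)
    (u v : Fin p → ℚ) (u' v' : Fin q → ℚ) :
    {ξ : Fin (p + q + 1) → ℝ | (∀ ι : Fin (p + q),
        Fin.append a a' ι < ξ (Fin.castSucc ι) ∧
        ξ (Fin.castSucc ι) < Fin.append a a' ι *
          (α ^ ((Fin.append u u' ι : ℚ) : ℝ) * β ^ ((Fin.append v v' ι : ℚ) : ℝ))) ∧
      0 < ξ (Fin.last (p + q)) ∧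
      ξ (Fin.last (p + q)) * ∏ ι : Fin (p + q), ξ (Fin.castSucc ι) < 1} =
    {w : Fin (p + q + 1) → ℝ |
      (fun ι : Fin p => w (Fin.castSucc (Fin.castAdd q ι))) ∈
        {x : Fin p → ℝ | ∀ ι, a ι < x ι ∧ x ι < a ι * (α ^ ((u ι : ℚ) : ℝ) * β ^ ((v ι : ℚ) : ℝ))} ∧
      (fun κ : Fin q => w (Fin.castSucc (Fin.natAdd p κ))) ∈
        {y : Fin q → ℝ | ∀ κ, a' κ < y κ ∧
          y κ < a' κ * (α ^ ((u' κ : ℚ) : ℝ) * β ^ ((v' κ : ℚ) : ℝ))} ∧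
      0 < w (Fin.last (p + q)) ∧
      w (Fin.last (p + q)) * ∏ j : Fin (p + q), w (Fin.castSucc j) < 1} := by
  ext w
  simp only [mem_setOf_eq, Fin.forall_fin_add, Fin.append_left, Fin.append_right, and_assoc]

/-! ## The stub -/

/-- **Stub v6-8 (PRODUCT CERTIFICATE: the certified class is closed under products).** If the
toric cells over `C ⊆ ℝ^p_{>0}` and `D ⊆ ℝ^q_{>0}` carry torsion certificates
`d • [cell_C] ≡ Σ w_j • [box_j]`, `d' • [cell_D] ≡ Σ w'_j • [box'_j]` over Λ-boxes, then the merged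
cell over `C × D` carries the certificate
`d d' • [cell_{C×D}] ≡ Σ_{j,j'} w_j w'_{j'} • [box_j × box'_{j'}]` (merged boxes are Λ-boxes in
torus dimension `p + q`): multiply the certificates in the ring `FormalRep` (`KZ.relations` is an
ideal, `KZProductIdeal`), and merge slacks on both sides with the landed `stub_slackMerge`.
[Kontsevich–Zagier 2001, §1.2, §4.1] [folklore] -/
theorem stub_productCertificate : ∀ (p q : ℕ) (α β : ℝ), 0 < α → 0 < β → IsAlgebraic ℚ α → IsAlgebraic ℚ β →
    ∀ (C : Set (Fin p → ℝ)) (D : Set (Fin q → ℝ))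
    (r : KZ.IntegralRep (p + 1)) (s : KZ.IntegralRep (q + 1)) (t : KZ.IntegralRep (p + q + 1)),
    Literature.ModelTheory.ExponentialFields.IsSemialgebraic ℚ C →
    Literature.ModelTheory.ExponentialFields.IsSemialgebraic ℚ D →
    (∀ x ∈ C, ∀ ι, 0 < x ι) → (∀ y ∈ D, ∀ κ, 0 < y κ) →
    r.domain = {w : Fin (p + 1) → ℝ | (fun ι : Fin p => w (Fin.castSucc ι)) ∈ C ∧
      0 < w (Fin.last p) ∧ w (Fin.last p) * ∏ ι : Fin p, w (Fin.castSucc ι) < 1} →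
    s.domain = {w : Fin (q + 1) → ℝ | (fun κ : Fin q => w (Fin.castSucc κ)) ∈ D ∧
      0 < w (Fin.last q) ∧ w (Fin.last q) * ∏ κ : Fin q, w (Fin.castSucc κ) < 1} →
    t.domain = {w : Fin (p + q + 1) → ℝ |
      (fun ι : Fin p => w (Fin.castSucc (Fin.castAdd q ι))) ∈ C ∧
      (fun κ : Fin q => w (Fin.castSucc (Fin.natAdd p κ))) ∈ D ∧
      0 < w (Fin.last (p + q)) ∧ w (Fin.last (p + q)) * ∏ j : Fin (p + q), w (Fin.castSucc j) < 1} →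
    (∀ w ∈ r.domain, r.integrand w = 1) → (∀ w ∈ s.domain, s.integrand w = 1) →
    (∀ w ∈ t.domain, t.integrand w = 1) →
    (∃ (d l : ℕ) (σ : Fin l → KZ.IntegralRep (p + 1)) (w : Fin l → ℤ), d ≠ 0 ∧
      (∀ j, w j ≠ 0 → ∃ (a : Fin (p) → ℝ) (u v : Fin (p) → ℚ),
      (∀ ξ ∈ (σ j).domain, (σ j).integrand ξ = 1) ∧ (∀ ι, 0 < a ι) ∧
      (∀ ι, IsAlgebraic ℚ (a ι)) ∧ (∀ ι, 1 < α ^ ((u ι : ℚ) : ℝ) * β ^ ((v ι : ℚ) : ℝ)) ∧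
      (σ j).domain = {ξ : Fin (p + 1) → ℝ | (∀ ι : Fin (p), a ι < ξ (Fin.castSucc ι) ∧
      ξ (Fin.castSucc ι) < a ι * (α ^ ((u ι : ℚ) : ℝ) * β ^ ((v ι : ℚ) : ℝ))) ∧
      0 < ξ (Fin.last (p)) ∧ ξ (Fin.last (p)) * ∏ ι : Fin (p), ξ (Fin.castSucc ι) < 1}) ∧
      d • KZ.of r - ∑ j, w j • KZ.of (σ j) ∈ KZ.relations) →
    (∃ (d l : ℕ) (σ : Fin l → KZ.IntegralRep (q + 1)) (w : Fin l → ℤ), d ≠ 0 ∧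
      (∀ j, w j ≠ 0 → ∃ (a : Fin (q) → ℝ) (u v : Fin (q) → ℚ),
      (∀ ξ ∈ (σ j).domain, (σ j).integrand ξ = 1) ∧ (∀ ι, 0 < a ι) ∧
      (∀ ι, IsAlgebraic ℚ (a ι)) ∧ (∀ ι, 1 < α ^ ((u ι : ℚ) : ℝ) * β ^ ((v ι : ℚ) : ℝ)) ∧
      (σ j).domain = {ξ : Fin (q + 1) → ℝ | (∀ ι : Fin (q), a ι < ξ (Fin.castSucc ι) ∧
      ξ (Fin.castSucc ι) < a ι * (α ^ ((u ι : ℚ) : ℝ) * β ^ ((v ι : ℚ) : ℝ))) ∧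
      0 < ξ (Fin.last (q)) ∧ ξ (Fin.last (q)) * ∏ ι : Fin (q), ξ (Fin.castSucc ι) < 1}) ∧
      d • KZ.of s - ∑ j, w j • KZ.of (σ j) ∈ KZ.relations) →
    ∃ (d l : ℕ) (σ : Fin l → KZ.IntegralRep (p + q + 1)) (w : Fin l → ℤ), d ≠ 0 ∧
        (∀ j, w j ≠ 0 → ∃ (a : Fin (p + q) → ℝ) (u v : Fin (p + q) → ℚ),
          (∀ ξ ∈ (σ j).domain, (σ j).integrand ξ = 1) ∧ (∀ ι, 0 < a ι) ∧
          (∀ ι, IsAlgebraic ℚ (a ι)) ∧ (∀ ι, 1 < α ^ ((u ι : ℚ) : ℝ) * β ^ ((v ι : ℚ) : ℝ)) ∧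
          (σ j).domain = {ξ : Fin (p + q + 1) → ℝ | (∀ ι : Fin (p + q), a ι < ξ (Fin.castSucc ι) ∧
            ξ (Fin.castSucc ι) < a ι * (α ^ ((u ι : ℚ) : ℝ) * β ^ ((v ι : ℚ) : ℝ))) ∧
            0 < ξ (Fin.last (p + q)) ∧ ξ (Fin.last (p + q)) * ∏ ι : Fin (p + q), ξ (Fin.castSucc ι) < 1}) ∧
        d • KZ.of t - ∑ j, w j • KZ.of (σ j) ∈ KZ.relations := by
  intro p q α β hα hβ hαa hβa C D r s t hC hD hC0 hD0 hr hs ht hr1 hs1 ht1 hcr hcs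
  obtain ⟨d, l, σ, w, hd, hσ, hrel⟩ := hcr
  obtain ⟨d', l', σ', w', hd', hσ', hrel'⟩ := hcs
  classical
  have hcor : ∀ uu vv : ℚ, IsAlgebraic ℚ (α ^ ((uu : ℚ) : ℝ) * β ^ ((vv : ℚ) : ℝ)) :=
    fun uu vv => (mxs_rpow_isAlgebraic hα hαa uu).mul (mxs_rpow_isAlgebraic hβ hβa vv)
  -- the box data as functions of the index
  obtain ⟨a, u, v, hbox⟩ := pcert_choice hσ
  obtain ⟨a', u', v', hbox'⟩ := pcert_choice hσ'
  -- integrand-`1` representations on the merged boxes (only needed for non-zero weights)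
  have hτex : ∀ jj' : Fin l × Fin l', ∃ τ : KZ.IntegralRep (p + q + 1),
      (w jj'.1 ≠ 0 ∧ w' jj'.2 ≠ 0) →
      τ.domain = {ξ : Fin (p + q + 1) → ℝ | (∀ ι : Fin (p + q),
          Fin.append (a jj'.1) (a' jj'.2) ι < ξ (Fin.castSucc ι) ∧
          ξ (Fin.castSucc ι) < Fin.append (a jj'.1) (a' jj'.2) ι *
            (α ^ ((Fin.append (u jj'.1) (u' jj'.2) ι : ℚ) : ℝ) *
              β ^ ((Fin.append (v jj'.1) (v' jj'.2) ι : ℚ) : ℝ))) ∧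
        0 < ξ (Fin.last (p + q)) ∧
        ξ (Fin.last (p + q)) * ∏ ι : Fin (p + q), ξ (Fin.castSucc ι) < 1} ∧
      τ.integrand = fun _ => 1 := by
    rintro ⟨j, j'⟩
    by_cases h : w j ≠ 0 ∧ w' j' ≠ 0
    · obtain ⟨-, ha0, haa, -, -⟩ := hbox j h.1
      obtain ⟨-, ha0', haa', -, -⟩ := hbox' j' h.2
      obtain ⟨τ, hτ⟩ := pcert_mergedBox_exists hα hβ hαa hβa (u j) (v j) (u' j') (v' j')
        ha0 ha0' haa haa'
      exact ⟨τ, fun _ => hτ⟩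
    · exact ⟨t, fun h' => absurd h' h⟩
  choose τ hτ using hτex
  -- the products of boxes merge (`stub_slackMerge` over the product of the two base boxes)
  have hmerge : ∀ j j', w j ≠ 0 → w' j' ≠ 0 →
      KZ.of (σ j) * KZ.of (σ' j') - KZ.of (τ (j, j')) ∈ KZ.relations := by
    intro j j' hj hj'
    obtain ⟨h1, ha0, haa, -, hdom⟩ := hbox j hj
    obtain ⟨h1', ha0', haa', -, hdom'⟩ := hbox' j' hj'
    obtain ⟨hτd, hτi⟩ := hτ (j, j') ⟨hj, hj'⟩
    refine stub_slackMerge p q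
      {x : Fin p → ℝ | ∀ ι, a j ι < x ι ∧
        x ι < a j ι * (α ^ ((u j ι : ℚ) : ℝ) * β ^ ((v j ι : ℚ) : ℝ))}
      {y : Fin q → ℝ | ∀ κ, a' j' κ < y κ ∧
        y κ < a' j' κ * (α ^ ((u' j' κ : ℚ) : ℝ) * β ^ ((v' j' κ : ℚ) : ℝ))}
      (σ j) (σ' j') (τ (j, j'))
      (pcert_isSemialgebraic_box haa fun ι => (haa ι).mul (hcor _ _))
      (pcert_isSemialgebraic_box haa' fun κ => (haa' κ).mul (hcor _ _))
      (fun x hx ι => (ha0 ι).trans (hx ι).1) (fun y hy κ => (ha0' κ).trans (hy κ).1)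
      hdom hdom' (hτd.trans (pcert_mergedBox_eq α β (a j) (a' j') (u j) (v j) (u' j') (v' j')))
      h1 h1' fun ξ _ => ?_
    rw [hτi]
  -- the algebra of certificates
  have halg := pcert_algebra (U := fun j j' => KZ.of (τ (j, j'))) hrel hrel'
    (stub_slackMerge p q C D r s t hC hD hC0 hD0 hr hs ht hr1 hs1 ht1) hmerge
  refine ⟨d * d', l * l', fun J => τ (finProdFinEquiv.symm J),
    fun J => w (finProdFinEquiv.symm J).1 * w' (finProdFinEquiv.symm J).2,
    mul_ne_zero hd hd', fun J hJ => ?_, ?_⟩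
  · -- every merged box of non-zero weight is a Λ-box of torus dimension `p + q`
    beta_reduce at hJ ⊢
    generalize finProdFinEquiv.symm J = jj at hJ ⊢
    obtain ⟨j, j'⟩ := jj
    obtain ⟨hj, hj'⟩ := mul_ne_zero_iff.mp hJ
    obtain ⟨-, ha0, haa, hg, -⟩ := hbox j hj
    obtain ⟨-, ha0', haa', hg', -⟩ := hbox' j' hj'
    obtain ⟨hτd, hτi⟩ := hτ (j, j') ⟨hj, hj'⟩
    refine ⟨Fin.append (a j) (a' j'), Fin.append (u j) (u' j'), Fin.append (v j) (v' j'),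
      fun ξ _ => by rw [hτi], fun ι => ?_, fun ι => ?_, fun ι => ?_, hτd⟩
    · induction ι using Fin.addCases with
      | left ι => simpa using ha0 ι
      | right κ => simpa using ha0' κ
    · induction ι using Fin.addCases with
      | left ι => simpa using haa ι
      | right κ => simpa using haa' κ
    · induction ι using Fin.addCases with
      | left ι => simpa using hg ι
      | right κ => simpa using hg' κ
  · -- the relation, after flattening the double sum along `finProdFinEquiv`
    have hsum : ∑ J : Fin (l * l'),
        (w (finProdFinEquiv.symm J).1 * w' (finProdFinEquiv.symm J).2) •
          KZ.of (τ (finProdFinEquiv.symm J)) =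
        ∑ j, ∑ j', (w j * w' j') • KZ.of (τ (j, j')) := by
      rw [← Fintype.sum_prod_type']
      exact Fintype.sum_equiv finProdFinEquiv.symm _ _ fun J => rfl
    rw [hsum]
    exact halg

end Summit.KontsevichZagierPeriods.SymplecticScissors.LogPolytope

end
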